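import Literature.NumberTheory.EllipticCurves.WeierstrassTransformationFive
import Literature.NumberTheory.EllipticCurves.GaussianLatticeFifthDivision
import HarnessLib

/-!
# The Gaussian lattice `ℤi + ℤ`: complex multiplication by `2 − i` (norm five) in closed form

Topic `Literature/NumberTheory/EllipticCurves`, namespace `Literature.NumberTheory.EllipticCurves.GaussianLattice`
(continuing `GaussianLatticeQuarterValues`, `GaussianLatticeFifthDivision`).  Everything here is **proved**; no
definition, no named fact.

`Λ = ℤi + ℤ`, `℘ = ℘_Λ`, `ϖ₀ = Γ(1/4)²/(2√(2π))`, `e₁ = ℘(1/2) = ϖ₀²`, `g₂ = 4ϖ₀⁴`, `g₃ = 0`; in the normalised coordinate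
`X = ℘/ϖ₀²` the curve of `Λ` is `y² = x³ − x`.  The endomorphism `[2 − i]` of `ℂ/Λ` has kernel
`(2 − i)⁻¹Λ/Λ = {0, ±w, ±iw}`, `w = (2 + i)/5` (`(2 − i)w = 1`, `2w ≡ iw (mod Λ)`), a cyclic superlattice of index `5`, so
the tree's order-five transformation (`PeriodPair.weierstrassP_sub_mul_of_indexFive`, Vélu) and the homogeneity
`℘_{α⁻¹Λ}(z) = α²℘_Λ(αz)` give `℘((2 − i)z)` as a rational function of `℘(z)` of degree `5`:

* `two_sub_I_mul_mem_lattice_iff` — `(2 − i)x ∈ Λ ↔ x ≡ 0, ±w, ±2w (mod Λ)` (private plumbing: `kw ∉ Λ` for `1 ≤ k ≤ 4`,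
  `℘(2w) = −℘(w)`);
* `weierstrassP_two_add_I_fifth_sq` — **`℘((2+i)/5)² = (1 − 2i)ϖ₀⁴/5`** (`PeriodPair.weierstrassP_sq_of_cmFive`:
  `2℘(w)² + 2℘(2w)² = (α⁴ + 19)G₄`, `α = 2 − i`, `G₄ = ϖ₀⁴/15`); `beta_mul_weierstrassP_sq_sub_ne_zero` — off the kernel
  `(1 + 2i)℘(z)² ≠ ϖ₀⁴`;
* `weierstrassP_two_sub_I_mul_velu` — the Vélu form
  `(2 − i)²℘((2 − i)z)(℘² − γϖ₀⁴)² = ℘((℘² − γϖ₀⁴)² + 4(3γ − 1)ϖ₀⁴℘² + 4(γ² − 3γ)ϖ₀⁸)`, `γ = (1 − 2i)/5`, for `(2 − i)z ∉ Λ`;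
* ★ `weierstrassP_two_sub_I_mul` — **`℘((2 − i)z) = −℘(z)(℘(z)² − βϖ₀⁴)²/(β℘(z)² − ϖ₀⁴)²`, `β = 1 + 2i`**, for `(2 − i)z ∉ Λ`
  (the denominator vanishes exactly on the kernel); normalised: `X((2 − i)z) = −X(X² − β)²/(βX² − 1)²`
  (`normalizedX_two_sub_I_mul`);
* the same in the coordinate `ρ = X⁻² = (ϖ₀²/℘)²`, in which complex multiplications by units are invisible:
  `rho_two_sub_I_mul` — `ρ((2 − i)z) = ρ(β − ρ)⁴/(1 − βρ)⁴`, and, from the tree's `weierstrassP_one_add_I_mul`,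
  `rho_one_add_I_mul` / `rho_one_sub_I_mul` — `ρ((1 ± i)z) = −4ρ/(1 − ρ)²` (`ρ(iz) = ρ(−z) = ρ(z)` being immediate).

These are the two generators needed to label all torsion points of `y² = x³ − x` of odd prime-power order inert in `ℤ[i]`
from one of them by complex multiplication (`(ℤ[i]/q)ˣ/μ₄` is cyclic; `1 + i` and `2 + i` generate it for `q = 7`), which is
how the BSD programme's `7`-division certificate (crux `ManinDatumSupercuspidalCMInert`) avoids the Galois theory of the
division field.  Classical (Abel, Eisenstein: the lemniscatic multiplication formulas); the norm-five formula is obtained here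
from Lawden's transformation theory as typed in the tree rather than quoted.

## References
* D. F. Lawden, *Elliptic Functions and Applications*, Springer 1989, §9.8 (transformation of order `n`). [Lawden1989]
* D. A. Cox, *Primes of the form x² + ny²*, 2nd ed., Wiley 2013, §10.B–C (complex multiplication, `℘(αz)` rational in `℘(z)`). [Cox2013]
* E. T. Whittaker, G. N. Watson, *A Course of Modern Analysis*, 4th ed., §20.33, §22.8 (lemniscate functions). [WhittakerWatson1927]

## Mathlib / tree search
Tree: `PeriodPair.weierstrassP_sub_mul_of_indexFive`, `PeriodPair.weierstrassP_sq_of_cmFive`, `PeriodPair.mem_mulLeft_inv_lattice`,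
`PeriodPair.weierstrassP_mulLeft` (`WeierstrassTransformationFive`, `RealLatticePeriod`); `GaussianLattice.weierstrassP_I_mul`,
`g₂_eq_varpi'`, `weierstrassP_one_add_I_mul`, `mem_lattice_iff`, `one_mem`, `I_mul_mem_lattice_ofUpperHalfPlane_I_iff`,
`g₃_ofUpperHalfPlane_I`.  Mathlib: `PeriodPair.weierstrassP_add_coe`, `PeriodPair.weierstrassP_neg`, `PeriodPair.g₂`,
`Complex.I_sq`.
-/

noncomputable section

open Complex PeriodPair Real

namespace Literature.NumberTheory.EllipticCurves

namespace GaussianLattice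

/-! ### The kernel of `2 − i`: the points `k(2 + i)/5` -/

/-- `(2 − i)(2 + i)/5 = 1`. [folklore] -/
private theorem two_sub_I_mul_two_add_I_fifth : (2 - I) * ((2 + I) / 5 : ℂ) = 1 := by
  have h : (2 - I) * (2 + I) = (5 : ℂ) := by linear_combination (-1 : ℂ) * I_sq
  rw [← mul_div_assoc, h, div_self (by norm_num : (5 : ℂ) ≠ 0)]

/-- A point `(u + vi)/5` (`u, v ∈ ℤ`) lies in `ℤi + ℤ` iff `5 ∣ u` and `5 ∣ v`. [folklore] -/
private theorem intCast_add_intCast_mul_I_div_five_mem_iff (u v : ℤ) :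
    (((u : ℂ) + v * I) / 5) ∈ (ofUpperHalfPlane UpperHalfPlane.I).lattice ↔ (5 : ℤ) ∣ u ∧ (5 : ℤ) ∣ v := by
  rw [mem_lattice_iff]
  constructor
  · rintro ⟨m, n, h⟩
    have h' : ((5 * n : ℤ) : ℂ) + ((5 * m : ℤ) : ℂ) * I = (u : ℂ) + (v : ℂ) * I := by
      push_cast; linear_combination (5 : ℂ) * h
    have hre := congrArg Complex.re h'
    have him := congrArg Complex.im h'
    simp only [Complex.add_re, Complex.intCast_re, Complex.mul_re, Complex.I_re, mul_zero, Complex.intCast_im,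
      Complex.I_im, mul_one, sub_self, add_zero, Complex.add_im, Complex.mul_im, zero_add] at hre him
    exact ⟨⟨n, by exact_mod_cast hre.symm⟩, ⟨m, by exact_mod_cast him.symm⟩⟩
  · rintro ⟨⟨a, rfl⟩, ⟨b, rfl⟩⟩
    exact ⟨b, a, by push_cast; ring⟩

/-- **`k(2 + i)/5 ∉ ℤi + ℤ` for `1 ≤ k ≤ 4`** (the kernel points of `[2 − i]` are nonzero modulo `Λ`). [folklore] -/
private theorem fifth_mul_two_add_I_notMem {k : ℕ} (hk1 : 1 ≤ k) (hk4 : k ≤ 4) :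
    (k : ℂ) * ((2 + I) / 5) ∉ (ofUpperHalfPlane UpperHalfPlane.I).lattice := by
  rw [show (k : ℂ) * ((2 + I) / 5) = (((2 * k : ℤ) : ℂ) + ((k : ℤ) : ℂ) * I) / 5 by push_cast; ring,
    intCast_add_intCast_mul_I_div_five_mem_iff]
  rintro ⟨-, h⟩
  omega

/-- `w = (2+i)/5 ∉ Λ`. [folklore] -/
private theorem two_add_I_fifth_notMem : ((2 + I) / 5 : ℂ) ∉ (ofUpperHalfPlane UpperHalfPlane.I).lattice := by
  simpa using fifth_mul_two_add_I_notMem (k := 1) le_rfl (by norm_num)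

/-- `2w ∉ Λ`. [folklore] -/
private theorem two_mul_two_add_I_fifth_notMem : 2 * ((2 + I) / 5 : ℂ) ∉ (ofUpperHalfPlane UpperHalfPlane.I).lattice := by
  exact_mod_cast fifth_mul_two_add_I_notMem (k := 2) (by norm_num) (by norm_num)

/-- `3w ∉ Λ`. [folklore] -/
private theorem three_mul_two_add_I_fifth_notMem : 3 * ((2 + I) / 5 : ℂ) ∉ (ofUpperHalfPlane UpperHalfPlane.I).lattice := by
  exact_mod_cast fifth_mul_two_add_I_notMem (k := 3) (by norm_num) (by norm_num)

/-- `4w ∉ Λ`. [folklore] -/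
private theorem four_mul_two_add_I_fifth_notMem : 4 * ((2 + I) / 5 : ℂ) ∉ (ofUpperHalfPlane UpperHalfPlane.I).lattice := by
  exact_mod_cast fifth_mul_two_add_I_notMem (k := 4) (by norm_num) le_rfl

/-- `Λ = ℤi + ℤ` is a `ℤ[i]`-module: `(2 − i)l ∈ Λ` for `l ∈ Λ`. [folklore] -/
private theorem two_sub_I_mul_mem {l : ℂ} (hl : l ∈ (ofUpperHalfPlane UpperHalfPlane.I).lattice) : (2 - I) * l ∈ (ofUpperHalfPlane UpperHalfPlane.I).lattice := by
  rw [mem_lattice_iff] at hl ⊢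
  obtain ⟨m, n, rfl⟩ := hl
  exact ⟨2 * m - n, 2 * n + m, by push_cast; linear_combination (m : ℂ) * I_sq⟩

/-- **The kernel of `[2 − i]`**: `(2 − i)x ∈ Λ ↔ x ≡ 0, w, −w, 2w, −2w (mod Λ)`, `w = (2 + i)/5` — the five-coset
hypothesis of `PeriodPair.weierstrassP_sq_of_cmFive` for `α = 2 − i` (`(2 − i)⁻¹Λ/Λ ≅ ℤ[i]/(2 − i) ≅ ℤ/5`, with `i ≡ 2`):
the system of representatives `{0, ±w, ±2w}` of `α⁻¹Λ/Λ` in the transformation of order five.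
[cite: Lawden1989, §9.8 eqs. (9.8.3)–(9.8.7), (9.8.14)] -/
theorem two_sub_I_mul_mem_lattice_iff (x : ℂ) :
    (2 - I) * x ∈ (ofUpperHalfPlane UpperHalfPlane.I).lattice ↔ x ∈ (ofUpperHalfPlane UpperHalfPlane.I).lattice ∨ x - (2 + I) / 5 ∈ (ofUpperHalfPlane UpperHalfPlane.I).lattice ∨ x + (2 + I) / 5 ∈ (ofUpperHalfPlane UpperHalfPlane.I).lattice ∨
      x - 2 * ((2 + I) / 5) ∈ (ofUpperHalfPlane UpperHalfPlane.I).lattice ∨ x + 2 * ((2 + I) / 5) ∈ (ofUpperHalfPlane UpperHalfPlane.I).lattice := by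
  have hw1 : (2 - I) * ((2 + I) / 5 : ℂ) = 1 := two_sub_I_mul_two_add_I_fifth
  constructor
  · intro hx
    obtain ⟨m, n, h⟩ := mem_lattice_iff.mp hx
    -- `x = ((2 − i)x)·(2 + i)/5 = (mi + n)(2 + i)/5`; `x − jw = (2q − m) + qi` whenever `2m + n − j = 5q`
    have hx' : x = ((m : ℂ) * I + n) * ((2 + I) / 5) := by
      rw [h]; linear_combination (-x) * hw1
    have key : ∀ j q : ℤ, 2 * m + n - j = 5 * q →
        x - (j : ℂ) * ((2 + I) / 5) = ((q : ℤ) : ℂ) * I + ((2 * q - m : ℤ) : ℂ) := by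
      intro j q hjq
      have hjq' : ((2 * m + n - j : ℤ) : ℂ) = ((5 * q : ℤ) : ℂ) := by rw [hjq]
      push_cast at hjq' ⊢
      apply mul_right_cancel₀ (by norm_num : (5 : ℂ) ≠ 0)
      have e5 : (x - (j : ℂ) * ((2 + I) / 5)) * 5 = ((m : ℂ) * I + n - j) * (2 + I) := by rw [hx']; ring
      rw [e5]
      linear_combination (I + 2) * hjq' + (m : ℂ) * I_sq
    have hmem : ∀ j q : ℤ, 2 * m + n - j = 5 * q → x - (j : ℂ) * ((2 + I) / 5) ∈ (ofUpperHalfPlane UpperHalfPlane.I).lattice := by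
      intro j q hjq
      rw [key j q hjq, mem_lattice_iff]
      exact ⟨q, 2 * q - m, rfl⟩
    have hr : (2 * m + n) % 5 = 0 ∨ (2 * m + n) % 5 = 1 ∨ (2 * m + n) % 5 = 2 ∨ (2 * m + n) % 5 = 3 ∨
        (2 * m + n) % 5 = 4 := by omega
    rcases hr with hr | hr | hr | hr | hr
    · refine Or.inl ?_
      have := hmem 0 ((2 * m + n) / 5) (by omega)
      simpa using this
    · refine Or.inr (Or.inl ?_)
      have := hmem 1 ((2 * m + n) / 5) (by omega)
      simpa using this
    · refine Or.inr (Or.inr (Or.inr (Or.inl ?_)))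
      have := hmem 2 ((2 * m + n) / 5) (by omega)
      simpa using this
    · refine Or.inr (Or.inr (Or.inr (Or.inr ?_)))
      have := hmem (-2) ((2 * m + n) / 5 + 1) (by omega)
      rw [show x + 2 * ((2 + I) / 5) = x - ((-2 : ℤ) : ℂ) * ((2 + I) / 5) by push_cast; ring]
      exact this
    · refine Or.inr (Or.inr (Or.inl ?_))
      have := hmem (-1) ((2 * m + n) / 5 + 1) (by omega)
      rw [show x + (2 + I) / 5 = x - ((-1 : ℤ) : ℂ) * ((2 + I) / 5) by push_cast; ring]
      exact this
  · have hw2 : (2 - I) * (2 * ((2 + I) / 5 : ℂ)) = 2 := by linear_combination (2 : ℂ) * hw1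
    have two_mem : (2 : ℂ) ∈ (ofUpperHalfPlane UpperHalfPlane.I).lattice := mem_lattice_iff.mpr ⟨0, 2, by push_cast; ring⟩
    rintro (h | h | h | h | h)
    · exact two_sub_I_mul_mem h
    · have := add_mem (two_sub_I_mul_mem h) one_mem
      rwa [mul_sub, hw1, sub_add_cancel] at this
    · have := sub_mem (two_sub_I_mul_mem h) one_mem
      rwa [mul_add, hw1, add_sub_cancel_right] at this
    · have := add_mem (two_sub_I_mul_mem h) two_mem
      rwa [mul_sub, hw2, sub_add_cancel] at this
    · have := sub_mem (two_sub_I_mul_mem h) two_mem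
      rwa [mul_add, hw2, add_sub_cancel_right] at this

/-! ### The division values at `w = (2 + i)/5` -/

/-- **`℘(2w) = −℘(w)`** for `w = (2 + i)/5`: `2w = iw + 1`, `℘` is `Λ`-periodic and `℘(iz) = −℘(z)`. [folklore] -/
private theorem weierstrassP_two_mul_two_add_I_fifth :
    ℘[ofUpperHalfPlane UpperHalfPlane.I] (2 * ((2 + I) / 5)) = -℘[ofUpperHalfPlane UpperHalfPlane.I] ((2 + I) / 5) := by
  have h : (2 * ((2 + I) / 5) : ℂ) = I * ((2 + I) / 5) + 1 := by
    field_simp; linear_combination (-1 : ℂ) * I_sq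
  rw [h, show (I * ((2 + I) / 5) + 1 : ℂ) = I * ((2 + I) / 5) + ((⟨1, one_mem⟩ : (ofUpperHalfPlane UpperHalfPlane.I).lattice) : ℂ) from rfl,
    PeriodPair.weierstrassP_add_coe, weierstrassP_I_mul]

/-- **`℘((2 + i)/5)² = (1 − 2i)ϖ₀⁴/5`** — the `x`-coordinate of the kernel of `[2 − i]` on `y² = x³ − x` satisfies
`x² = (1 − 2i)/5 = 1/(1 + 2i)`: the first norm-five CM relation `2℘(w)² + 2℘(2w)² = (α⁴ + 19)G₄` (tree
`PeriodPair.weierstrassP_sq_of_cmFive`) with `α = 2 − i`, `α⁴ = −7 − 24i`, `℘(2w) = −℘(w)`, `G₄ = g₂/60 = ϖ₀⁴/15`.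
[cite: Cox2013, §10.C (10.21)–(10.22) (method, norm 5)] -/
theorem weierstrassP_two_add_I_fifth_sq :
    ℘[ofUpperHalfPlane UpperHalfPlane.I] ((2 + I) / 5) ^ 2 = (1 - 2 * I) / 5 * ((Real.Gamma (1 / 4) ^ 2 / (2 * Real.sqrt (2 * π)) : ℝ) : ℂ) ^ 4 := by
  have hα : (2 - I : ℂ) ≠ 0 := by
    intro h; have := congrArg Complex.re h; norm_num at this
  have h := PeriodPair.weierstrassP_sq_of_cmFive (L := ofUpperHalfPlane UpperHalfPlane.I) (w := (2 + I) / 5) hα two_sub_I_mul_mem_lattice_iff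
    two_add_I_fifth_notMem two_mul_two_add_I_fifth_notMem three_mul_two_add_I_fifth_notMem four_mul_two_add_I_fifth_notMem
  rw [weierstrassP_two_mul_two_add_I_fifth] at h
  have hG : (ofUpperHalfPlane UpperHalfPlane.I).G 4 = ((Real.Gamma (1 / 4) ^ 2 / (2 * Real.sqrt (2 * π)) : ℝ) : ℂ) ^ 4 / 15 := by
    have hg : (ofUpperHalfPlane UpperHalfPlane.I).g₂ = 60 * (ofUpperHalfPlane UpperHalfPlane.I).G 4 := rfl
    rw [g₂_eq_varpi'] at hg
    linear_combination (-1 / 60 : ℂ) * hg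
  rw [hG] at h
  have hα4 : (2 - I : ℂ) ^ 4 = -7 - 24 * I := by
    linear_combination (I ^ 2 - 8 * I + 23) * I_sq
  rw [hα4] at h
  linear_combination (1 / 4 : ℂ) * h

/-! ### Complex multiplication by `2 − i` -/

/-- **Vélu form of `[2 − i]`**: for `(2 − i)z ∉ Λ`, with `γ = (1 − 2i)/5` and `W = ϖ₀⁴`,
`(2 − i)²℘((2 − i)z)·(℘(z)² − γW)² = ℘(z)·((℘(z)² − γW)² + 4(3γ − 1)W℘(z)² + 4(γ² − 3γ)W²)` — the order-five
transformation `℘_{α⁻¹Λ} = ℘ + Σ_{c = ±w, ±2w} ℘(· − c) − 2℘(w) − 2℘(2w)` with the symmetric addition formula (tree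
`PeriodPair.weierstrassP_sub_mul_of_indexFive`), `℘_{α⁻¹Λ}(z) = α²℘(αz)`, `℘(2w) = −℘(w)`, `℘(w)² = γW`, `g₂ = 4W`, `g₃ = 0`.
[cite: Lawden1989, §9.8 eqs. (9.8.3)–(9.8.7), (9.8.14)] -/
theorem weierstrassP_two_sub_I_mul_velu {z : ℂ} (hz : (2 - I) * z ∉ (ofUpperHalfPlane UpperHalfPlane.I).lattice) :
    (2 - I) ^ 2 * ℘[ofUpperHalfPlane UpperHalfPlane.I] ((2 - I) * z) * (℘[ofUpperHalfPlane UpperHalfPlane.I] z ^ 2 - (1 - 2 * I) / 5 * ((Real.Gamma (1 / 4) ^ 2 / (2 * Real.sqrt (2 * π)) : ℝ) : ℂ) ^ 4) ^ 2 =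
      ℘[ofUpperHalfPlane UpperHalfPlane.I] z * ((℘[ofUpperHalfPlane UpperHalfPlane.I] z ^ 2 - (1 - 2 * I) / 5 * ((Real.Gamma (1 / 4) ^ 2 / (2 * Real.sqrt (2 * π)) : ℝ) : ℂ) ^ 4) ^ 2 +
        4 * (3 * ((1 - 2 * I) / 5) - 1) * ((Real.Gamma (1 / 4) ^ 2 / (2 * Real.sqrt (2 * π)) : ℝ) : ℂ) ^ 4 * ℘[ofUpperHalfPlane UpperHalfPlane.I] z ^ 2 +
        4 * (((1 - 2 * I) / 5) ^ 2 - 3 * ((1 - 2 * I) / 5)) * (((Real.Gamma (1 / 4) ^ 2 / (2 * Real.sqrt (2 * π)) : ℝ) : ℂ) ^ 4) ^ 2) := by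
  have hα : (2 - I : ℂ) ≠ 0 := by
    intro h; have := congrArg Complex.re h; norm_num at this
  set L' : PeriodPair := (ofUpperHalfPlane UpperHalfPlane.I).mulLeft (2 - I)⁻¹ (inv_ne_zero hα) with hL'
  have hΛ' : ∀ x, x ∈ L'.lattice ↔ x ∈ (ofUpperHalfPlane UpperHalfPlane.I).lattice ∨ x - (2 + I) / 5 ∈ (ofUpperHalfPlane UpperHalfPlane.I).lattice ∨ x + (2 + I) / 5 ∈ (ofUpperHalfPlane UpperHalfPlane.I).lattice ∨
      x - 2 * ((2 + I) / 5) ∈ (ofUpperHalfPlane UpperHalfPlane.I).lattice ∨ x + 2 * ((2 + I) / 5) ∈ (ofUpperHalfPlane UpperHalfPlane.I).lattice := fun x ↦ by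
    rw [hL', PeriodPair.mem_mulLeft_inv_lattice hα]; exact two_sub_I_mul_mem_lattice_iff x
  have hz' : z ∉ L'.lattice := by rwa [hL', PeriodPair.mem_mulLeft_inv_lattice hα]
  have H := PeriodPair.weierstrassP_sub_mul_of_indexFive hΛ' two_add_I_fifth_notMem two_mul_two_add_I_fifth_notMem
    three_mul_two_add_I_fifth_notMem four_mul_two_add_I_fifth_notMem hz'
  -- homogeneity `℘_{α⁻¹Λ}(z) = α²℘(αz)`
  have hhom : ℘[L'] z = (2 - I) ^ 2 * ℘[ofUpperHalfPlane UpperHalfPlane.I] ((2 - I) * z) := by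
    have h := PeriodPair.weierstrassP_mulLeft (2 - I)⁻¹ (inv_ne_zero hα) (ofUpperHalfPlane UpperHalfPlane.I) ((2 - I) * z)
    rw [← mul_assoc, inv_mul_cancel₀ hα, one_mul] at h
    rw [hL', h, inv_pow, inv_inv]
  rw [hhom, weierstrassP_two_mul_two_add_I_fifth, g₂_eq_varpi', g₃_ofUpperHalfPlane_I] at H
  set e : ℂ := ℘[ofUpperHalfPlane UpperHalfPlane.I] ((2 + I) / 5) with he
  set P : ℂ := ℘[ofUpperHalfPlane UpperHalfPlane.I] z
  set Q : ℂ := ℘[ofUpperHalfPlane UpperHalfPlane.I] ((2 - I) * z)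
  set W : ℂ := ((Real.Gamma (1 / 4) ^ 2 / (2 * Real.sqrt (2 * π)) : ℝ) : ℂ) ^ 4 with hW
  have he2 : e ^ 2 = (1 - 2 * I) / 5 * W := weierstrassP_two_add_I_fifth_sq
  -- the expanded right-hand side only involves even powers of `e`
  have H2 : ((2 - I) ^ 2 * Q - P) * (P ^ 2 - e ^ 2) ^ 2 =
      4 * P * ((3 * e ^ 2 - W) * P ^ 2 + e ^ 2 * e ^ 2 - 3 * W * e ^ 2) := by
    linear_combination H
  rw [he2] at H2
  linear_combination H2

/-- **Off the kernel the closed-form denominator does not vanish**: for `(2 − i)z ∉ Λ`,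
`(1 + 2i)℘(z)² ≠ ϖ₀⁴` (equality would force `℘(z)² = ℘(w)²`, i.e. `z ≡ ±w, ±iw (mod Λ)`, the kernel of `[2 − i]`): the poles of
the transformation of order five are the nonzero representatives. [cite: Lawden1989, §9.8 eqs. (9.8.3)–(9.8.7), (9.8.14)] -/
theorem beta_mul_weierstrassP_sq_sub_ne_zero {z : ℂ} (hz : (2 - I) * z ∉ (ofUpperHalfPlane UpperHalfPlane.I).lattice) :
    (1 + 2 * I) * ℘[ofUpperHalfPlane UpperHalfPlane.I] z ^ 2 - ((Real.Gamma (1 / 4) ^ 2 / (2 * Real.sqrt (2 * π)) : ℝ) : ℂ) ^ 4 ≠ 0 := by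
  set P : ℂ := ℘[ofUpperHalfPlane UpperHalfPlane.I] z with hP
  set W : ℂ := ((Real.Gamma (1 / 4) ^ 2 / (2 * Real.sqrt (2 * π)) : ℝ) : ℂ) ^ 4 with hW
  have hzΛ : z ∉ (ofUpperHalfPlane UpperHalfPlane.I).lattice := fun h ↦ hz (two_sub_I_mul_mem h)
  intro h0
  have hP2 : P ^ 2 = ℘[ofUpperHalfPlane UpperHalfPlane.I] ((2 + I) / 5) ^ 2 := by
    rw [weierstrassP_two_add_I_fifth_sq, ← hW]
    have h5 : (1 + 2 * I) * ((1 - 2 * I) / 5) = (1 : ℂ) := by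
      linear_combination (-(4 : ℂ) / 5) * I_sq
    linear_combination ((1 - 2 * I) / 5) * h0 + (-(P ^ 2)) * h5
  have hw := two_add_I_fifth_notMem
  rcases sq_eq_sq_iff_eq_or_eq_neg.mp hP2 with h | h
  · rcases ((ofUpperHalfPlane UpperHalfPlane.I).weierstrassP_eq_weierstrassP_iff hzΛ hw).mp h with h' | h'
    · -- `z + w ∈ Λ`: `(2 − i)z = (2 − i)(z + w) − 1`
      exact hz (by
        have := sub_mem (two_sub_I_mul_mem h') one_mem
        rwa [mul_add, two_sub_I_mul_two_add_I_fifth, add_sub_cancel_right] at this)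
    · exact hz (by
        have := add_mem (two_sub_I_mul_mem h') one_mem
        rwa [mul_sub, two_sub_I_mul_two_add_I_fifth, sub_add_cancel] at this)
  · rw [← weierstrassP_I_mul] at h
    have hIw : I * ((2 + I) / 5) ∉ (ofUpperHalfPlane UpperHalfPlane.I).lattice := by
      rw [I_mul_mem_lattice_ofUpperHalfPlane_I_iff]; exact hw
    have hIw1 : (2 - I) * (I * ((2 + I) / 5) : ℂ) = I := by
      linear_combination I * two_sub_I_mul_two_add_I_fifth
    have hI : (I : ℂ) ∈ (ofUpperHalfPlane UpperHalfPlane.I).lattice := by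
      simpa using (I_mul_mem_lattice_ofUpperHalfPlane_I_iff 1).mpr one_mem
    rcases ((ofUpperHalfPlane UpperHalfPlane.I).weierstrassP_eq_weierstrassP_iff hzΛ hIw).mp h with h' | h'
    · exact hz (by
        have := sub_mem (two_sub_I_mul_mem h') hI
        rwa [mul_add, hIw1, add_sub_cancel_right] at this)
    · exact hz (by
        have := add_mem (two_sub_I_mul_mem h') hI
        rwa [mul_sub, hIw1, sub_add_cancel] at this)

/-- **Complex multiplication by `2 − i` on `ℤi + ℤ`, closed form**: for `(2 − i)z ∉ Λ`, with `β = 1 + 2i`,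
`℘((2 − i)z) = −℘(z)(℘(z)² − βϖ₀⁴)²/(β℘(z)² − ϖ₀⁴)²`; the denominator vanishes exactly on the kernel
`{0, ±w, ±iw}` (`℘(±w)² = ℘(±iw)² = ϖ₀⁴/β`).  (Vélu form with `βγ = 1`, `β² = −(2 − i)²`,
`(X² − γ)² + 4(3γ − 1)X² + 4(γ² − 3γ) = (X² − β)²`.)  A lemniscatic multiplication formula of norm five.
[cite: Lawden1989, §9.8 eqs. (9.8.3)–(9.8.7), (9.8.14)] -/
theorem weierstrassP_two_sub_I_mul {z : ℂ} (hz : (2 - I) * z ∉ (ofUpperHalfPlane UpperHalfPlane.I).lattice) :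
    ℘[ofUpperHalfPlane UpperHalfPlane.I] ((2 - I) * z) =
      -(℘[ofUpperHalfPlane UpperHalfPlane.I] z * (℘[ofUpperHalfPlane UpperHalfPlane.I] z ^ 2 - (1 + 2 * I) * ((Real.Gamma (1 / 4) ^ 2 / (2 * Real.sqrt (2 * π)) : ℝ) : ℂ) ^ 4) ^ 2) /
        ((1 + 2 * I) * ℘[ofUpperHalfPlane UpperHalfPlane.I] z ^ 2 - ((Real.Gamma (1 / 4) ^ 2 / (2 * Real.sqrt (2 * π)) : ℝ) : ℂ) ^ 4) ^ 2 := by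
  have A := weierstrassP_two_sub_I_mul_velu hz
  have hden := beta_mul_weierstrassP_sq_sub_ne_zero hz
  set P : ℂ := ℘[ofUpperHalfPlane UpperHalfPlane.I] z with hP
  set Q : ℂ := ℘[ofUpperHalfPlane UpperHalfPlane.I] ((2 - I) * z)
  set W : ℂ := ((Real.Gamma (1 / 4) ^ 2 / (2 * Real.sqrt (2 * π)) : ℝ) : ℂ) ^ 4 with hW
  -- scalar identities using `i² = −1`
  have hN : (P ^ 2 - (1 - 2 * I) / 5 * W) ^ 2 + 4 * (3 * ((1 - 2 * I) / 5) - 1) * W * P ^ 2 +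
      4 * (((1 - 2 * I) / 5) ^ 2 - 3 * ((1 - 2 * I) / 5)) * W ^ 2 = (P ^ 2 - (1 + 2 * I) * W) ^ 2 := by
    linear_combination (-(16 : ℂ) / 5 * W ^ 2) * I_sq
  have hD : ((1 + 2 * I) * P ^ 2 - W) ^ 2 = (1 + 2 * I) ^ 2 * (P ^ 2 - (1 - 2 * I) / 5 * W) ^ 2 := by
    linear_combination (-(4 : ℂ) / 5 * W * (2 * (1 + 2 * I) * P ^ 2 - W - (1 + 2 * I) * ((1 - 2 * I) / 5) * W)) * I_sq
  have hαβ : (2 - I : ℂ) ^ 2 = -(1 + 2 * I) ^ 2 := by linear_combination (5 : ℂ) * I_sq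
  have A' : (2 - I) ^ 2 * Q * (P ^ 2 - (1 - 2 * I) / 5 * W) ^ 2 = P * (P ^ 2 - (1 + 2 * I) * W) ^ 2 := by
    rw [← hN]; linear_combination A
  rw [eq_div_iff (pow_ne_zero 2 hden), hD]
  linear_combination (-1 : ℂ) * A' + (Q * (P ^ 2 - (1 - 2 * I) / 5 * W) ^ 2) * hαβ

/-- **Normalised form**: with `X(z) = ℘(z)/ϖ₀²` (the coordinate of `y² = x³ − x`) and `β = 1 + 2i`, for `(2 − i)z ∉ Λ`,
`X((2 − i)z) = −X(z)(X(z)² − β)²/(βX(z)² − 1)²`. [cite: Lawden1989, §9.8 eqs. (9.8.3)–(9.8.7), (9.8.14)] -/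
theorem normalizedX_two_sub_I_mul {z : ℂ} (hz : (2 - I) * z ∉ (ofUpperHalfPlane UpperHalfPlane.I).lattice) :
    ℘[ofUpperHalfPlane UpperHalfPlane.I] ((2 - I) * z) / ((Real.Gamma (1 / 4) ^ 2 / (2 * Real.sqrt (2 * π)) : ℝ) : ℂ) ^ 2 =
      -(℘[ofUpperHalfPlane UpperHalfPlane.I] z / ((Real.Gamma (1 / 4) ^ 2 / (2 * Real.sqrt (2 * π)) : ℝ) : ℂ) ^ 2 * ((℘[ofUpperHalfPlane UpperHalfPlane.I] z / ((Real.Gamma (1 / 4) ^ 2 / (2 * Real.sqrt (2 * π)) : ℝ) : ℂ) ^ 2) ^ 2 - (1 + 2 * I)) ^ 2) /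
        ((1 + 2 * I) * (℘[ofUpperHalfPlane UpperHalfPlane.I] z / ((Real.Gamma (1 / 4) ^ 2 / (2 * Real.sqrt (2 * π)) : ℝ) : ℂ) ^ 2) ^ 2 - 1) ^ 2 := by
  have h := weierstrassP_two_sub_I_mul hz
  have hden := beta_mul_weierstrassP_sq_sub_ne_zero hz
  rw [h]
  set P : ℂ := ℘[ofUpperHalfPlane UpperHalfPlane.I] z
  set c : ℂ := ((Real.Gamma (1 / 4) ^ 2 / (2 * Real.sqrt (2 * π)) : ℝ) : ℂ) with hc
  have hϖ : c ≠ 0 := varpi_complex_ne_zero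
  have hc2 : c ^ 2 ≠ 0 := pow_ne_zero 2 hϖ
  have hden' : (1 + 2 * I) * (P / c ^ 2) ^ 2 - 1 ≠ 0 := by
    intro h0
    apply hden
    have e : (1 + 2 * I) * P ^ 2 - c ^ 4 = ((1 + 2 * I) * (P / c ^ 2) ^ 2 - 1) * c ^ 4 := by
      field_simp
    rw [e, h0, zero_mul]
  field_simp

/-! ### The coordinate `ρ = (ϖ₀²/℘)²`: units act trivially, `[1 ± i]` and `[2 − i]` act by rational maps over `ℚ(i)` -/

/-- `ρ = (X)⁻¹² = ϖ₀⁴/℘²` spelled out. [folklore] -/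
private theorem rho_eq (z : ℂ) :
    (℘[ofUpperHalfPlane UpperHalfPlane.I] z / ((Real.Gamma (1 / 4) ^ 2 / (2 * Real.sqrt (2 * π)) : ℝ) : ℂ) ^ 2)⁻¹ ^ 2 = (((Real.Gamma (1 / 4) ^ 2 / (2 * Real.sqrt (2 * π)) : ℝ) : ℂ) ^ 2) ^ 2 / ℘[ofUpperHalfPlane UpperHalfPlane.I] z ^ 2 := by
  rw [inv_div, div_pow]

/-- `ρ(−z) = ρ(z)` for `ρ = (ϖ₀²/℘)²` (`℘` is even). [folklore] -/
private theorem rho_neg (z : ℂ) :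
    (℘[ofUpperHalfPlane UpperHalfPlane.I] (-z) / ((Real.Gamma (1 / 4) ^ 2 / (2 * Real.sqrt (2 * π)) : ℝ) : ℂ) ^ 2)⁻¹ ^ 2 = (℘[ofUpperHalfPlane UpperHalfPlane.I] z / ((Real.Gamma (1 / 4) ^ 2 / (2 * Real.sqrt (2 * π)) : ℝ) : ℂ) ^ 2)⁻¹ ^ 2 := by
  rw [PeriodPair.weierstrassP_neg]

/-- `ρ(iz) = ρ(z)` (`℘(iz) = −℘(z)`). [folklore] -/
private theorem rho_I_mul (z : ℂ) :
    (℘[ofUpperHalfPlane UpperHalfPlane.I] (I * z) / ((Real.Gamma (1 / 4) ^ 2 / (2 * Real.sqrt (2 * π)) : ℝ) : ℂ) ^ 2)⁻¹ ^ 2 = (℘[ofUpperHalfPlane UpperHalfPlane.I] z / ((Real.Gamma (1 / 4) ^ 2 / (2 * Real.sqrt (2 * π)) : ℝ) : ℂ) ^ 2)⁻¹ ^ 2 := by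
  rw [weierstrassP_I_mul, neg_div, inv_neg, neg_sq]

/-- **`[1 + i]` in the coordinate `ρ`**: for `u ∉ Λ` with `℘(u) ≠ 0` and `℘((1 + i)u) ≠ 0`,
`ρ((1 + i)u) = −4ρ(u)/(1 − ρ(u))²` (`X((1 + i)u) = −i(X² − 1)/(2X)`, tree `weierstrassP_one_add_I_mul`): the
instance `α = 1 + i` of "`℘(αz)` is a rational function of `℘(z)`". [cite: Cox2013, §10.B Thm. 10.14 (proof, (ii) ⇒ (iii))] -/
theorem rho_one_add_I_mul {u : ℂ} (hu : u ∉ (ofUpperHalfPlane UpperHalfPlane.I).lattice) (h0 : ℘[ofUpperHalfPlane UpperHalfPlane.I] u ≠ 0) (h1 : ℘[ofUpperHalfPlane UpperHalfPlane.I] ((1 + I) * u) ≠ 0) :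
    (℘[ofUpperHalfPlane UpperHalfPlane.I] ((1 + I) * u) / ((Real.Gamma (1 / 4) ^ 2 / (2 * Real.sqrt (2 * π)) : ℝ) : ℂ) ^ 2)⁻¹ ^ 2 =
      -4 * (℘[ofUpperHalfPlane UpperHalfPlane.I] u / ((Real.Gamma (1 / 4) ^ 2 / (2 * Real.sqrt (2 * π)) : ℝ) : ℂ) ^ 2)⁻¹ ^ 2 / (1 - (℘[ofUpperHalfPlane UpperHalfPlane.I] u / ((Real.Gamma (1 / 4) ^ 2 / (2 * Real.sqrt (2 * π)) : ℝ) : ℂ) ^ 2)⁻¹ ^ 2) ^ 2 := by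
  have h := weierstrassP_one_add_I_mul hu h0
  rw [rho_eq, rho_eq]
  set P : ℂ := ℘[ofUpperHalfPlane UpperHalfPlane.I] u with hP
  set Q : ℂ := ℘[ofUpperHalfPlane UpperHalfPlane.I] ((1 + I) * u) with hQ
  set c : ℂ := ((Real.Gamma (1 / 4) ^ 2 / (2 * Real.sqrt (2 * π)) : ℝ) : ℂ) with hc
  have hϖ : c ≠ 0 := varpi_complex_ne_zero
  have hA : P ^ 2 - c ^ 4 ≠ 0 := by
    intro h0'
    rw [h0', mul_zero, zero_div] at h
    exact h1 h
  have hsq : Q ^ 2 = -(P ^ 2 - c ^ 4) ^ 2 / (4 * P ^ 2) := by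
    rw [h, div_pow]
    congr 1
    · linear_combination ((P ^ 2 - c ^ 4) ^ 2) * I_sq
    · ring
  have hc2 : c ^ 2 ≠ 0 := pow_ne_zero 2 hϖ
  have hP2 : P ^ 2 ≠ 0 := pow_ne_zero 2 h0
  have hQ2 : Q ^ 2 ≠ 0 := pow_ne_zero 2 h1
  have hA' : (c ^ 2) ^ 2 - P ^ 2 ≠ 0 := by
    intro h0'; apply hA; linear_combination -h0'
  have hB : P ^ 2 - (c ^ 2) ^ 2 ≠ 0 := by
    intro h0'; apply hA; linear_combination h0'
  rw [hsq]
  field_simp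

/-- **`[1 − i]` in the coordinate `ρ`**: `ρ((1 − i)u) = ρ((1 + i)u) = −4ρ(u)/(1 − ρ(u))²` (`(1 − i)u = −i(1 + i)u`,
`℘` even, `℘(iz) = −℘(z)`). [cite: Cox2013, §10.B Thm. 10.14 (proof, (ii) ⇒ (iii))] -/
theorem rho_one_sub_I_mul {u : ℂ} (hu : u ∉ (ofUpperHalfPlane UpperHalfPlane.I).lattice) (h0 : ℘[ofUpperHalfPlane UpperHalfPlane.I] u ≠ 0) (h1 : ℘[ofUpperHalfPlane UpperHalfPlane.I] ((1 - I) * u) ≠ 0) :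
    (℘[ofUpperHalfPlane UpperHalfPlane.I] ((1 - I) * u) / ((Real.Gamma (1 / 4) ^ 2 / (2 * Real.sqrt (2 * π)) : ℝ) : ℂ) ^ 2)⁻¹ ^ 2 =
      -4 * (℘[ofUpperHalfPlane UpperHalfPlane.I] u / ((Real.Gamma (1 / 4) ^ 2 / (2 * Real.sqrt (2 * π)) : ℝ) : ℂ) ^ 2)⁻¹ ^ 2 / (1 - (℘[ofUpperHalfPlane UpperHalfPlane.I] u / ((Real.Gamma (1 / 4) ^ 2 / (2 * Real.sqrt (2 * π)) : ℝ) : ℂ) ^ 2)⁻¹ ^ 2) ^ 2 := by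
  have e : (1 - I) * u = -(I * ((1 + I) * u)) := by linear_combination u * I_sq
  have h1' : ℘[ofUpperHalfPlane UpperHalfPlane.I] ((1 + I) * u) ≠ 0 := by
    rw [e, PeriodPair.weierstrassP_neg, weierstrassP_I_mul, neg_ne_zero] at h1
    exact h1
  rw [e, rho_neg, rho_I_mul]
  exact rho_one_add_I_mul hu h0 h1'

/-- **`[2 − i]` in the coordinate `ρ`**: for `(2 − i)z ∉ Λ` with `℘(z) ≠ 0` and `℘((2 − i)z) ≠ 0`, and `β = 1 + 2i`,
`ρ((2 − i)z) = ρ(z)(β − ρ(z))⁴/(1 − βρ(z))⁴`. [cite: Lawden1989, §9.8 eqs. (9.8.3)–(9.8.7), (9.8.14)] -/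
theorem rho_two_sub_I_mul {z : ℂ} (hz : (2 - I) * z ∉ (ofUpperHalfPlane UpperHalfPlane.I).lattice) (h0 : ℘[ofUpperHalfPlane UpperHalfPlane.I] z ≠ 0)
    (h1 : ℘[ofUpperHalfPlane UpperHalfPlane.I] ((2 - I) * z) ≠ 0) :
    (℘[ofUpperHalfPlane UpperHalfPlane.I] ((2 - I) * z) / ((Real.Gamma (1 / 4) ^ 2 / (2 * Real.sqrt (2 * π)) : ℝ) : ℂ) ^ 2)⁻¹ ^ 2 =
      (℘[ofUpperHalfPlane UpperHalfPlane.I] z / ((Real.Gamma (1 / 4) ^ 2 / (2 * Real.sqrt (2 * π)) : ℝ) : ℂ) ^ 2)⁻¹ ^ 2 * ((1 + 2 * I) - (℘[ofUpperHalfPlane UpperHalfPlane.I] z / ((Real.Gamma (1 / 4) ^ 2 / (2 * Real.sqrt (2 * π)) : ℝ) : ℂ) ^ 2)⁻¹ ^ 2) ^ 4 /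
        (1 - (1 + 2 * I) * (℘[ofUpperHalfPlane UpperHalfPlane.I] z / ((Real.Gamma (1 / 4) ^ 2 / (2 * Real.sqrt (2 * π)) : ℝ) : ℂ) ^ 2)⁻¹ ^ 2) ^ 4 := by
  have h := weierstrassP_two_sub_I_mul hz
  have hden := beta_mul_weierstrassP_sq_sub_ne_zero hz
  rw [rho_eq, rho_eq]
  set P : ℂ := ℘[ofUpperHalfPlane UpperHalfPlane.I] z with hP
  set Q : ℂ := ℘[ofUpperHalfPlane UpperHalfPlane.I] ((2 - I) * z) with hQ
  set c : ℂ := ((Real.Gamma (1 / 4) ^ 2 / (2 * Real.sqrt (2 * π)) : ℝ) : ℂ) with hc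
  have hϖ : c ≠ 0 := varpi_complex_ne_zero
  -- the numerator of the closed form is nonzero as well
  have hnum : P ^ 2 - (1 + 2 * I) * c ^ 4 ≠ 0 := by
    intro h0'
    rw [h0', zero_pow two_ne_zero, mul_zero, neg_zero, zero_div] at h
    exact h1 h
  have hsq : Q ^ 2 = (P * (P ^ 2 - (1 + 2 * I) * c ^ 4) ^ 2) ^ 2 / (((1 + 2 * I) * P ^ 2 - c ^ 4) ^ 2) ^ 2 := by
    rw [h, neg_div, neg_sq, div_pow]
  have hc2 : c ^ 2 ≠ 0 := pow_ne_zero 2 hϖ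
  have hP2 : P ^ 2 ≠ 0 := pow_ne_zero 2 h0
  have hQ2 : Q ^ 2 ≠ 0 := pow_ne_zero 2 h1
  have hA : (c ^ 2) ^ 2 - (1 + 2 * I) * P ^ 2 ≠ 0 := by
    intro h0'; apply hden; linear_combination -h0'
  have hA' : P ^ 2 - (1 + 2 * I) * (c ^ 2) ^ 2 ≠ 0 := by
    intro h0'; apply hnum; linear_combination h0'
  have hB : (1 + 2 * I) * (c ^ 2) ^ 2 - P ^ 2 ≠ 0 := by
    intro h0'; apply hnum; linear_combination -h0'
  have hB' : (1 + 2 * I) * P ^ 2 - (c ^ 2) ^ 2 ≠ 0 := by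
    intro h0'; apply hden; linear_combination h0'
  rw [hsq]
  field_simp

end GaussianLattice

end Literature.NumberTheory.EllipticCurves

end
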